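import Summits.QuantumFields.YangMills.Theorems.BalabanUVNodesClustersCore
import Summits.QuantumFields.BalabanUV.T4Continuum.Support.HistoryBankingRoundingWindow
import Literature.MathematicalPhysics.QuantumFieldTheory.Balaban1983to89.T4PersistenceRenewal
import Literature.MathematicalPhysics.QuantumFieldTheory.Balaban1983to89.T4MatchingClosure
import Literature.MathematicalPhysics.QuantumFieldTheory.Balaban1983to89.T4FiniteEpsInhabited

/-!
# BalabanUVNodes ∕ N20 in the RENEWAL currency — node N20 = NE7b (`T4WeightBudget.RelWeightBound`) BY NAME from the cell's SECOND typed road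
# (Peierls ∕ single-slot ∕ fibre-rate ∕ event dominations, lineage `t4-ne7b-p2` + `T4HistoryPeeling`), per-event credit = print's ROUNDED renewal
# factor; exact carriers, the K5 stub `YMDAG.UVSplit.S_N20 SRec` at the spine carriers, and the guards (Track A, DAG node N20; strategy s3)

Cell `pub-ymgap` (HUMAN RULING D-0062), seat `pub-ymgap-dag-n20-d` (R134 fan-out, strategy s3 «alternative currency»; director-ym R134 row
«W_K < 1, Σ W_K < ∞ from [B16] (1.79)–(1.89) pp. 383–387 directly»; dag-lead FAN-OUT v1.1 §N20 s3 «rounded-renewal currency»).  Kernel bookkeeping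
BY NAME over LANDED hypothesis shapes; 0 `def`, 0 `sorry`, standard axioms; COUNT-NEUTRAL (N20 is NOT discharged — see HONEST FRAMING).
Companions (the FIRST road, P1 = pinned-class relative extraction `Spine/NE7b/PinnedExtraction.ExtractionLaws`, owner ruling W-ne7bp1-g103-2):
`BalabanUVNodesN20Knit` (p409854), `…N20KnitThreshold` (p411645), `…N20KnitLogCut` (p412464), `…N20KnitDerived` (p410322), `…N20AtSpineCarriers`
(p421432).  Those modules give N20 closers ONLY in the P1 currency; this module gives them in the second one.

THE SECOND CURRENCY (what «renewal currency» means here, located).  The cell's second typed road to NE7b's output shape reaches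
`RelWeightBound` through TERM-RATIO (Peierls) dominations instead of pinned-class partial sums:
* `T4PeierlsDomination.PeierlsDom l₀ T A Bad S` (erasure + charge + fibre domination, slot budget `S`), `PosDom` (KP-free pinned gas) —
  `relWeightBound_of_peierlsDom ∕ _of_posDom` (weights `1 − e^{−S K}`);
* `T4HistoryPeeling.SlotDom l₀ T A Bad S` (a switch-off structure; per slot `i` and context `τ″` with slot `i` clear, the insertion fibre carries at most
  `x i · A τ″`, `Σ x ≤ S K`) — `relWeightBound_of_slotDom(_twoRate)`, the log-cut forms `T4MatchingClosure.relWeightBound_of_slotDom_log ∕ _twoRate_log`;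
* `T4PersistenceRenewal.FibreRate l₀ T A Bad C V Λ σ j⋆` (old birth scales `j i < j⋆ K`, the R4 count `#{i : j i = j₀} ≤ V·Λ^{K−j₀}`, fibre rate
  `C·σ^{K − j i}`) and `EventDom l₀ T A Bad z η B₀ D V Λ j⋆` (an event forest per fibre: RENEWAL CHAINS with windows, the scale PAIRING
  `pairing_eps_of_credit`: `κ₁·W + E ≤ P ⇒ e^{E₀−P}·(e^{κ₁})^W ≤ e^{E₀−E}`) — `relWeightBound_of_fibreRate ∕ _of_eventDom`.
Per-event CREDIT in this currency: a renewal event (kind `1` of `T4PersistenceDictionary.PEv` = «the product `Π′ exp(−p₀(g_j))` of (1.79) p. 383;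
hence K = R_{j+1} for Z» p. 386) carries `HistoryConstants.pcredit O C g e = p₀(g_h)` (`pcredit_kind1`, `PrintedO1s.renewal P := P`) — PRINT's
ROUNDED renewal factor: [Balaban1989LargeFieldII] p. 383 after (1.78), «exp(−R_j^{−d−5}p₁²(g_j)).  This is the largest factor among all the small
factors we have obtained from the large field characteristic functions in the preparatory steps.  We assume that 2p₁ − (d + 5)r₀ > p₀, and we estimate the
factors by exp(−p₀(g_j))».  The ROUNDING itself is typed (not here): the letter `HistoryBankingSharpShares.sRsharp (d+5) 1 p₁ R g h = R_h^{−(d+5)}·p₁(g_h)²`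
(= `B16HistoryTowerEndDataLWR.sRrnd`, print's `r_h`), the proviso `HistoryBankingRoundingWindow.exponentProviso383_of_expR`, the identification
`neg_sRsharp_eq` (= `B16Sect1Kernels.lfFactor178`'s exponent) and the window clause `renew_clause` («booked credit + share ≤ r_h»); §2 below DISPLAYS the
rounding at the credit this currency books (`renewalCredit_le_roundedLetter`) and the credit inside the pairing (`pairing_of_renewalCredit`).
WHY AN ALTERNATIVE AND NOT A DUPLICATE: the road of record (P1, re-cut at `ExtractionLaws`) asks the (α)-instance for RELATIVE PARTIAL SUMS per pinned old
genealogy («LCS-j», printed nowhere — [Balaban1989LargeFieldII] p. 383 l. 21–28 states the A_j-field factor ABSOLUTELY); this road asks for a CONTEXT-UNIFORM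
TERM RATIO `weight(history with the structure ∕ event) ≤ x · weight(history without it)` inside the positive weights of (1.104) p. 391 (cell gap
G-ne7bp2-1, `T4RenewalChains` header: «exactly the failure of multiplicativity»).  Neither instance exists (NODE 00 pins no term classes; NC-NE7b-α UNRULED);
the two are different obligations on the same object, and a record predicate `SRec` delivering EITHER closes `S_N20` by name — P1 by the companions, the
second currency by §3 here.

CONTENTS.
§1 EXACT CARRIERS (carrier-abstract): `relWeightBound_of_slotDom_slot` — two runs' `SlotDom` with THEIR OWN budgets `S_A`, `S_B` and a pinned slot `W`
   dominating `1 − e^{−S_A K}`, `1 − e^{−S_B K}`, `0 ≤ W K < 1`, `Σ W < ∞` ⇒ `RelWeightBound l₀ T A B Bad W` VERBATIM (the record-matching form: the tree's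
   `relWeightBound_of_slotDom` wants ONE common budget and concludes at the weight `1 − e^{−S}`); `relWeightBound_of_slotDom_pair` (no slot: heterogeneous
   budgets, weight `1 − e^{−(S_A K + S_B K)}`, by `T4MatchingClosure.slotDom_mono`); `relWeightBound_of_peierlsDom_slot`, `relWeightBound_of_posDom_slot`;
   `relWeightBound_of_fibreRate_slot` (the two runs' `FibreRate` at THEIR OWN constants `(C, V, Λ, σ, j⋆)` ∕ `(C′, V′, Λ′, σ′, j⋆′)` — run B is the
   `K+1`-step run, its cut and rates need not be run A's), `relWeightBound_of_fibreRate_pair`, `relWeightBound_of_eventDom_slot`.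
§2 THE ROUNDED RENEWAL CREDIT: `renewalCredit_le_roundedLetter` (on the sharp window, the credit this currency books at a renewal, `pcredit = p₀(g_h)`, is
   below print's rounded letter `r_h = sRsharp (d+5) 1 p₁ R g h` — `renew_clause` with the share dropped); `pairing_of_renewalCredit` (the scale pairing
   `pairing_eps_of_credit` at the booked renewal credit: `κ₁·W + E ≤ p₀(g_h)` ⇒ `e^{E₀ − pcredit}·(e^{κ₁})^W ≤ e^{E₀ − E}`).
§3 AT THE SPINE CARRIERS (the K5 stub `YMDAG.UVSplit.S_N20 SRec` of `BalabanUVNodesClustersCore`, refinement-generic over every carrier predicate carrying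
   a producer of this currency): `s_N20_of_slotDomReading`, `s_N20_of_peierlsDomReading`, `s_N20_of_fibreRateReading`, `s_N20_of_eventDomReading`.
§4 GUARDS: `slotDom_productModel` ∕ `bad_productModel_nonempty` ∕ `relWeightBound_productModel` — the currency is INHABITED with NON-EMPTY bad classes:
   `T4HistoryPeeling.slotDom_product` (the independent-structure model, `n+1` slots of activity `(1∕2)^{K+1}∕(n+1)`) carries `SlotDom` at the budget
   `(1∕2)^{K+1}` and §1 fires at that slot; `s_N20_fires_on_slotDomReading` — an `SRec` over `SU(2)` data pinning that bundle is inhabited, the bundle CARRIES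
   the single-slot reading, and `S_N20` FIRES on it through §3's `s_N20_of_slotDomReading`.

HONEST FRAMING.  NE7b is the cell `pub-balaban`'s OWN estimate — NOT PRINTED for Bałaban's d = 4 procedure, NOT PROVED; printed MODEL [King1986]
(3.10)–(3.11) p. 656.  Every domination, rate, window and credit below is a HYPOTHESIS; nothing of Bałaban's is asserted, valued or instantiated; N20 is
NOT discharged (0∕1 at every record; typed 28∕28, discharged count untouched); the missing object in THIS currency is the context-uniform term ratio
(G-ne7bp2-1), in the road of record the relative partial sums (LCS-j) — both OBJECT-bound ((A1c), NC-NE7b-α UNRULED).  One finite four-torus programme at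
fixed `ε` — NOT ℝ⁴, NOT infinite volume, NOT OS, NOT a mass gap, NOT Clay.  Restate-immune (neither the Theses file nor any ∃-currency module imported).
Sources (locators only): T. Bałaban, CMP **122** (1989) 355–392 [Balaban1989LargeFieldII] (1.79) p. 383, p. 383 after (1.78), p. 386, (1.104) p. 391;
C. King, CMP **102** (1986) [King1986] (3.10)–(3.11) p. 656.  No decl below carries a cite tag.
-/

open Finset

namespace Summit.QuantumFields.YangMills.BalabanUVNodes.N20RenewalCurrency

open Literature.MathematicalPhysics.QuantumFieldTheory.Balaban1983to89
open Literature.MathematicalPhysics.QuantumFieldTheory.Balaban1983to89.T4Continuum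
open T4WeightBudget (RelWeightBound)
open T4PeierlsDomination (PeierlsDom PosDom)
open T4HistoryPeeling (SlotDom SwitchOff productSwitchOff productWeight slotDom_product twoRateBudget_nonneg summable_twoRateBudget)
open T4PersistenceRenewal (FibreRate EventDom pairing_eps_of_credit)
open T4PersistenceDictionary (PEv)
open T4MatchingClosure (slotDom_mono)
open Summit.QuantumFields.BalabanUV.T4Continuum.HistoryConstants (PrintedO1s pcredit pcredit_kind1)
open Summit.QuantumFields.BalabanUV.T4Continuum.HistoryBankingSharpShares (ell sRsharp)
open Summit.QuantumFields.BalabanUV.T4Continuum.HistoryBankingDiscountCharge (dshare dshare_nonneg)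
open Summit.QuantumFields.BalabanUV.T4Continuum.HistoryBankingRoundingWindow (SharpWindow renew_clause)
open YMDAG.UVSplit (Datum SpineCarriers SpineRecordPred S_N20)

noncomputable section

/-! ## §1 Exact carriers: the node from the second currency's dominations, with a pinned slot -/

section Abstract

variable {ι : Type*} [DecidableEq ι] {l₀ : ℝ} {T : ℕ → Finset ι} {A B : ℕ → ℝ → ι → ℝ} {Bad : ℕ → ℝ → Finset ι} {SA SB W : ℕ → ℝ}

/-- **THE NODE FROM TWO SINGLE-SLOT DOMINATIONS WITH THEIR OWN BUDGETS, AT A PINNED SLOT.**  Run A's `SlotDom` with budget `S_A`, run B's with budget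
`S_B` (same classes `T`, same bad classes `Bad`), nonnegative term weights, and a slot `W` with `1 − e^{−S_A K} ≤ W K`, `1 − e^{−S_B K} ≤ W K`,
`0 ≤ W K < 1`, `Σ W < ∞` ⇒ `RelWeightBound l₀ T A B Bad W` VERBATIM (`SlotDom.bad_le` per run; the bad class IS the switch-off structure's, hence
`⊆ T K`). [bookkeeping] -/
theorem relWeightBound_of_slotDom_slot (hDA : SlotDom l₀ T A Bad SA) (hDB : SlotDom l₀ T B Bad SB)
    (hA : ∀ (K : ℕ) (t : ℝ), |t| ≤ l₀ → ∀ τ ∈ T K, 0 ≤ A K t τ) (hB : ∀ (K : ℕ) (t : ℝ), |t| ≤ l₀ → ∀ τ ∈ T K, 0 ≤ B K t τ)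
    (hWA : ∀ K, 1 - Real.exp (-SA K) ≤ W K) (hWB : ∀ K, 1 - Real.exp (-SB K) ≤ W K)
    (hW0 : ∀ K, 0 ≤ W K) (hW1 : ∀ K, W K < 1) (hWs : Summable W) :
    RelWeightBound l₀ T A B Bad W where
  bad_subset := (hDA.toPeierlsDom hA).bad_subset
  nonneg := hW0
  lt_one := hW1
  summable := hWs
  bad_left K t ht := (hDA.bad_le hA K t ht).trans (mul_le_mul_of_nonneg_right (hWA K) (Finset.sum_nonneg (hA K t ht)))
  bad_right K t ht := (hDB.bad_le hB K t ht).trans (mul_le_mul_of_nonneg_right (hWB K) (Finset.sum_nonneg (hB K t ht)))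

/-- **HETEROGENEOUS BUDGETS, NO SLOT**: `SlotDom` of run A at `S_A ≥ 0` and of run B at `S_B ≥ 0`, both summable, nonnegative weights ⇒
`RelWeightBound` at the weight `1 − e^{−(S_A K + S_B K)}` (both dominations moved to the common budget `S_A + S_B` by `T4MatchingClosure.slotDom_mono`,
then `T4HistoryPeeling.relWeightBound_of_slotDom`). [bookkeeping] -/
theorem relWeightBound_of_slotDom_pair (hDA : SlotDom l₀ T A Bad SA) (hDB : SlotDom l₀ T B Bad SB)
    (hSA : ∀ K, 0 ≤ SA K) (hSB : ∀ K, 0 ≤ SB K) (hsA : Summable SA) (hsB : Summable SB)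
    (hA : ∀ (K : ℕ) (t : ℝ), |t| ≤ l₀ → ∀ τ ∈ T K, 0 ≤ A K t τ) (hB : ∀ (K : ℕ) (t : ℝ), |t| ≤ l₀ → ∀ τ ∈ T K, 0 ≤ B K t τ) :
    RelWeightBound l₀ T A B Bad fun K => 1 - Real.exp (-(SA K + SB K)) :=
  T4HistoryPeeling.relWeightBound_of_slotDom (fun K => add_nonneg (hSA K) (hSB K)) (hsA.add hsB) hA hB
    (slotDom_mono hDA fun K => le_add_of_nonneg_right (hSB K)) (slotDom_mono hDB fun K => le_add_of_nonneg_left (hSA K))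

/-- **THE NODE FROM TWO PEIERLS DOMINATIONS WITH THEIR OWN BUDGETS, AT A PINNED SLOT** (`T4PeierlsDomination.PeierlsDom`: erasure + charge + fibre
domination; `PeierlsDom.bad_le` per run). [bookkeeping] -/
theorem relWeightBound_of_peierlsDom_slot (hPA : PeierlsDom l₀ T A Bad SA) (hPB : PeierlsDom l₀ T B Bad SB)
    (hA : ∀ (K : ℕ) (t : ℝ), |t| ≤ l₀ → ∀ τ ∈ T K, 0 ≤ A K t τ) (hB : ∀ (K : ℕ) (t : ℝ), |t| ≤ l₀ → ∀ τ ∈ T K, 0 ≤ B K t τ)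
    (hWA : ∀ K, 1 - Real.exp (-SA K) ≤ W K) (hWB : ∀ K, 1 - Real.exp (-SB K) ≤ W K)
    (hW0 : ∀ K, 0 ≤ W K) (hW1 : ∀ K, W K < 1) (hWs : Summable W) :
    RelWeightBound l₀ T A B Bad W where
  bad_subset := hPA.bad_subset
  nonneg := hW0
  lt_one := hW1
  summable := hWs
  bad_left K t ht := (hPA.bad_le hA K t ht).trans (mul_le_mul_of_nonneg_right (hWA K) (Finset.sum_nonneg (hA K t ht)))
  bad_right K t ht := (hPB.bad_le hB K t ht).trans (mul_le_mul_of_nonneg_right (hWB K) (Finset.sum_nonneg (hB K t ht)))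

omit [DecidableEq ι] in
/-- **THE NODE FROM TWO KP-FREE GAS DOMINATIONS WITH THEIR OWN BUDGETS, AT A PINNED SLOT** (`T4PeierlsDomination.PosDom`; `PosDom.bad_le` per run).
[bookkeeping] -/
theorem relWeightBound_of_posDom_slot (hPA : PosDom l₀ T A Bad SA) (hPB : PosDom l₀ T B Bad SB)
    (hA : ∀ (K : ℕ) (t : ℝ), |t| ≤ l₀ → ∀ τ ∈ T K, 0 ≤ A K t τ) (hB : ∀ (K : ℕ) (t : ℝ), |t| ≤ l₀ → ∀ τ ∈ T K, 0 ≤ B K t τ)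
    (hWA : ∀ K, 1 - Real.exp (-SA K) ≤ W K) (hWB : ∀ K, 1 - Real.exp (-SB K) ≤ W K)
    (hW0 : ∀ K, 0 ≤ W K) (hW1 : ∀ K, W K < 1) (hWs : Summable W) :
    RelWeightBound l₀ T A B Bad W where
  bad_subset := hPA.bad_subset
  nonneg := hW0
  lt_one := hW1
  summable := hWs
  bad_left K t ht := (hPA.bad_le K t ht).trans (mul_le_mul_of_nonneg_right (hWA K) (Finset.sum_nonneg (hA K t ht)))
  bad_right K t ht := (hPB.bad_le K t ht).trans (mul_le_mul_of_nonneg_right (hWB K) (Finset.sum_nonneg (hB K t ht)))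

/-- **THE NODE FROM TWO FIBRE-RATE DOMINATIONS AT THEIR OWN CONSTANTS, AT A PINNED SLOT.**  Run A's `FibreRate` at `(C, V, Λ, σ, j⋆)`, run B's at
`(C′, V′, Λ′, σ′, j⋆′)` (signs, `Λσ < 1`, `Λ′σ′ < 1`, cuts `j⋆ K ≤ K`, `j⋆′ K ≤ K`), nonnegative weights, and a slot `W` dominating the two two-rate
weights `1 − exp(−C·V·(Λσ)^{K − j⋆ K + 1}∕(1 − Λσ))`, `1 − exp(−C′·V′·(Λ′σ′)^{K − j⋆′ K + 1}∕(1 − Λ′σ′))`, `0 ≤ W K < 1`, `Σ W < ∞` ⇒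
`RelWeightBound l₀ T A B Bad W` (`FibreRate.toSlotDom` per run, then `relWeightBound_of_slotDom_slot`; the tree's `relWeightBound_of_fibreRate` wants ONE
set of constants for both runs). [bookkeeping] -/
theorem relWeightBound_of_fibreRate_slot {C V Λ σ C' V' Λ' σ' : ℝ} {jstar jstar' : ℕ → ℕ}
    (hC : 0 ≤ C) (hV : 0 ≤ V) (hΛ : 0 ≤ Λ) (hσ : 0 ≤ σ) (hr : Λ * σ < 1) (hj : ∀ K, jstar K ≤ K)
    (hC' : 0 ≤ C') (hV' : 0 ≤ V') (hΛ' : 0 ≤ Λ') (hσ' : 0 ≤ σ') (hr' : Λ' * σ' < 1) (hj' : ∀ K, jstar' K ≤ K)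
    (hA : ∀ (K : ℕ) (t : ℝ), |t| ≤ l₀ → ∀ τ ∈ T K, 0 ≤ A K t τ) (hB : ∀ (K : ℕ) (t : ℝ), |t| ≤ l₀ → ∀ τ ∈ T K, 0 ≤ B K t τ)
    (hFA : FibreRate l₀ T A Bad C V Λ σ jstar) (hFB : FibreRate l₀ T B Bad C' V' Λ' σ' jstar')
    (hWA : ∀ K, 1 - Real.exp (-(C * V * ((Λ * σ) ^ (K - jstar K + 1) / (1 - Λ * σ)))) ≤ W K)
    (hWB : ∀ K, 1 - Real.exp (-(C' * V' * ((Λ' * σ') ^ (K - jstar' K + 1) / (1 - Λ' * σ')))) ≤ W K)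
    (hW0 : ∀ K, 0 ≤ W K) (hW1 : ∀ K, W K < 1) (hWs : Summable W) :
    RelWeightBound l₀ T A B Bad W :=
  relWeightBound_of_slotDom_slot (hFA.toSlotDom hC hV hΛ hσ hr hj) (hFB.toSlotDom hC' hV' hΛ' hσ' hr' hj') hA hB hWA hWB hW0 hW1 hWs

/-- **HETEROGENEOUS FIBRE RATES, NO SLOT**: the same two `FibreRate`s with `0 < Λσ`, `0 < Λ′σ′` and a positive fraction of old steps under each cut
(`c·K ≤ K − j⋆ K`, `c′·K ≤ K − j⋆′ K`) ⇒ `RelWeightBound` at the weight `1 − exp(−(S_A K + S_B K))`, `S_A`, `S_B` the two two-rate budgets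
(`relWeightBound_of_slotDom_pair`; summability `T4HistoryPeeling.summable_twoRateBudget`). [bookkeeping] -/
theorem relWeightBound_of_fibreRate_pair {C V Λ σ C' V' Λ' σ' c c' : ℝ} {jstar jstar' : ℕ → ℕ}
    (hC : 0 ≤ C) (hV : 0 ≤ V) (hΛ : 0 ≤ Λ) (hσ : 0 ≤ σ) (h0 : 0 < Λ * σ) (hr : Λ * σ < 1) (hj : ∀ K, jstar K ≤ K)
    (hc : 0 < c) (hfrac : ∀ K : ℕ, c * K ≤ ((K - jstar K : ℕ) : ℝ))
    (hC' : 0 ≤ C') (hV' : 0 ≤ V') (hΛ' : 0 ≤ Λ') (hσ' : 0 ≤ σ') (h0' : 0 < Λ' * σ') (hr' : Λ' * σ' < 1) (hj' : ∀ K, jstar' K ≤ K)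
    (hc' : 0 < c') (hfrac' : ∀ K : ℕ, c' * K ≤ ((K - jstar' K : ℕ) : ℝ))
    (hA : ∀ (K : ℕ) (t : ℝ), |t| ≤ l₀ → ∀ τ ∈ T K, 0 ≤ A K t τ) (hB : ∀ (K : ℕ) (t : ℝ), |t| ≤ l₀ → ∀ τ ∈ T K, 0 ≤ B K t τ)
    (hFA : FibreRate l₀ T A Bad C V Λ σ jstar) (hFB : FibreRate l₀ T B Bad C' V' Λ' σ' jstar') :
    RelWeightBound l₀ T A B Bad fun K =>
      1 - Real.exp (-(C * V * ((Λ * σ) ^ (K - jstar K + 1) / (1 - Λ * σ)) +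
        C' * V' * ((Λ' * σ') ^ (K - jstar' K + 1) / (1 - Λ' * σ')))) :=
  relWeightBound_of_slotDom_pair (hFA.toSlotDom hC hV hΛ hσ hr hj) (hFB.toSlotDom hC' hV' hΛ' hσ' hr' hj')
    (twoRateBudget_nonneg hC hV h0.le hr jstar) (twoRateBudget_nonneg hC' hV' h0'.le hr' jstar')
    (summable_twoRateBudget hC hV h0 hr hc hfrac) (summable_twoRateBudget hC' hV' h0' hr' hc' hfrac') hA hB

/-- **THE NODE FROM TWO EVENT DOMINATIONS AT THEIR OWN CONSTANTS, AT A PINNED SLOT** (renewal chains per fibre: `EventDom` at tilt `z > Λ > 0`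
resp. `z′ > Λ′ > 0`, defects `η, η′ > 0`, root budgets `B₀, B₀′ ≥ 0`, terminal constants `D, D′ ≥ 0`, R4 constants `V, V′ ≥ 0`, cuts `j⋆ K ≤ K`,
`j⋆′ K ≤ K`; `EventDom.toFibreRate` per run with `C = B₀D∕η`, `σ = z⁻¹`, then `relWeightBound_of_fibreRate_slot`). [bookkeeping] -/
theorem relWeightBound_of_eventDom_slot {z η B₀ D V Λ z' η' B₀' D' V' Λ' : ℝ} {jstar jstar' : ℕ → ℕ}
    (hη : 0 < η) (hB₀ : 0 ≤ B₀) (hD : 0 ≤ D) (hV : 0 ≤ V) (hΛ : 0 < Λ) (hzΛ : Λ < z) (hj : ∀ K, jstar K ≤ K)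
    (hη' : 0 < η') (hB₀' : 0 ≤ B₀') (hD' : 0 ≤ D') (hV' : 0 ≤ V') (hΛ' : 0 < Λ') (hzΛ' : Λ' < z') (hj' : ∀ K, jstar' K ≤ K)
    (hA : ∀ (K : ℕ) (t : ℝ), |t| ≤ l₀ → ∀ τ ∈ T K, 0 ≤ A K t τ) (hB : ∀ (K : ℕ) (t : ℝ), |t| ≤ l₀ → ∀ τ ∈ T K, 0 ≤ B K t τ)
    (hEA : EventDom l₀ T A Bad z η B₀ D V Λ jstar) (hEB : EventDom l₀ T B Bad z' η' B₀' D' V' Λ' jstar')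
    (hWA : ∀ K, 1 - Real.exp (-(B₀ * D / η * V * ((Λ * z⁻¹) ^ (K - jstar K + 1) / (1 - Λ * z⁻¹)))) ≤ W K)
    (hWB : ∀ K, 1 - Real.exp (-(B₀' * D' / η' * V' * ((Λ' * z'⁻¹) ^ (K - jstar' K + 1) / (1 - Λ' * z'⁻¹)))) ≤ W K)
    (hW0 : ∀ K, 0 ≤ W K) (hW1 : ∀ K, W K < 1) (hWs : Summable W) :
    RelWeightBound l₀ T A B Bad W := by
  have hz : 0 < z := hΛ.trans hzΛ
  have hz' : 0 < z' := hΛ'.trans hzΛ'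
  have hr : Λ * z⁻¹ < 1 := by rw [← div_eq_mul_inv, div_lt_one hz]; exact hzΛ
  have hr' : Λ' * z'⁻¹ < 1 := by rw [← div_eq_mul_inv, div_lt_one hz']; exact hzΛ'
  exact relWeightBound_of_fibreRate_slot (div_nonneg (mul_nonneg hB₀ hD) hη.le) hV hΛ.le (inv_nonneg.2 hz.le) hr hj
    (div_nonneg (mul_nonneg hB₀' hD') hη'.le) hV' hΛ'.le (inv_nonneg.2 hz'.le) hr' hj' hA hB
    (hEA.toFibreRate hz hη hB₀ hA) (hEB.toFibreRate hz' hη' hB₀' hB) hWA hWB hW0 hW1 hWs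

end Abstract

/-! ## §2 The rounded renewal credit: below print's rounded letter on the window; inside the scale pairing -/

section Rounding

/-- **THE BOOKED RENEWAL CREDIT INSIDE THE SCALE PAIRING.**  For a renewal event `e` (kind `1`; `pcredit O C g e = p₀(g_{h})`, `h = step − 1`,
`HistoryConstants.pcredit_kind1`): if the rate `κ₁` over the event's window `W` plus the margin `E` is paid by `p₀(g_h)` — `κ₁·W + E ≤ p0Profile C.A₀ C.p₀
(g h)` — then `e^{E₀ − pcredit O C g e}·(e^{κ₁})^W ≤ e^{E₀ − E}`, the per-event pairing `T4PersistenceRenewal.pairing_eps_of_credit` consumed by the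
column condition `gen_of_credit` of this currency's event forests. [bookkeeping] -/
theorem pairing_of_renewalCredit (O : PrintedO1s) (C : T4PrintedShapeBanking.Consts) (g : ℕ → ℝ) {e : PEv} (he : e.kind = 1)
    {κ₁ E E₀ : ℝ} {W : ℕ} (h : κ₁ * W + E ≤ p0Profile C.A₀ C.p₀ (g (e.step - 1))) :
    Real.exp (E₀ - pcredit O C g e) * Real.exp κ₁ ^ W ≤ Real.exp (E₀ - E) := by
  rw [pcredit_kind1 he]
  exact pairing_eps_of_credit h

variable {C : T4PrintedShapeBanking.Consts} {O : PrintedO1s} {L K r p₁ η η' κ : ℕ} {Φ : ℝ} {R : ℕ → ℕ} {g : ℕ → ℝ} {β' β₀ : ℝ}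

/-- **THE CREDIT THIS CURRENCY BOOKS AT A RENEWAL IS BELOW PRINT's ROUNDED RENEWAL LETTER** (the rounding displayed).  On the sharp window
`SharpWindow C O L K r p₁ (O.d + 5) η η′ κ 1 Φ g` (exponent bookkeeping `p₀ + r(d+5) + η = 2p₁` = print's proviso «2p₁ − (d+5)r₀ > p₀» with the gap `η`
named; `1 ≤ ℓ_j`; the four size clauses), under the (2.9) flow step `FlowIneq29`, the (2.5) envelope `R_j ≤ L·ℓ_j^{r}` and `1 ≤ R_j`, with `E₂, E₃ ≥ 0`:
for every performed renewal event `e` (kind `1`, step `≤ K`) the booked credit `pcredit O C g e = p₀(g_{h})`, `h = step − 1`, is at most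
`sRsharp (O.d + 5) 1 p₁ R g h = R_h^{−(d+5)}·p₁(g_h)²` — print's `r_h` (`HistoryBankingRoundingWindow.renew_clause` with the nonnegative share dropped).
[bookkeeping] -/
theorem renewalCredit_le_roundedLetter (hE₂ : 0 ≤ C.E₂) (hE₃ : 0 ≤ C.E₃) (hL : 1 ≤ L) (hA₀ : 0 ≤ C.A₀) (hΦ : 0 ≤ Φ)
    (h29 : B14FlowStep.FlowIneq29 R g L β' β₀ K) (hRup : ∀ j, j ≤ K → (R j : ℝ) ≤ L * ell g j ^ r)
    (hR1 : ∀ j, j ≤ K → 1 ≤ R j) (hW : SharpWindow C O L K r p₁ (O.d + 5) η η' κ 1 Φ g)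
    {e : PEv} (he : e.kind = 1) (hK : e.step ≤ K) :
    pcredit O C g e ≤ sRsharp (O.d + 5) 1 p₁ R g (e.step - 1) :=
  le_trans (le_add_of_nonneg_right (mul_nonneg (show (0 : ℝ) ≤ 1 + Φ by linarith) (dshare_nonneg (L := L) (R := R) hE₂ hE₃ e)))
    (renew_clause hL hA₀ hΦ h29 hRup hR1 hW he hK)

end Rounding

/-! ## §3 At the spine carriers: `S_N20 SRec` for every carrier predicate carrying a producer of this currency -/

section Spine

variable {N : ℕ} [NeZero N]

/-- **`S_N20` FOR EVERY SINGLE-SLOT READING.**  If `SRec` hands, with every bundle `S` it pins, the two runs' `SlotDom` over `S.T`, `S.Bad` with their own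
budgets, nonnegative weights on the classes, and the record's slot `S.W` dominating both weights `1 − e^{−S_A K}`, `1 − e^{−S_B K}` with `0 ≤ S.W K < 1`,
`Σ S.W < ∞` — then `S_N20 SRec` (§1 `relWeightBound_of_slotDom_slot`). [bookkeeping] -/
theorem s_N20_of_slotDomReading (SRec : SpineRecordPred N)
    (hread : ∀ (F : T4Family) (D : Datum F N) (g₀ : ℕ → ℝ) (os : List (ULoop F)) (S : SpineCarriers), SRec F D g₀ os S →
      ∃ SA SB : ℕ → ℝ, (letI := S.dec; SlotDom S.l₀ S.T S.A S.Bad SA) ∧ (letI := S.dec; SlotDom S.l₀ S.T S.B S.Bad SB) ∧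
        (∀ (K : ℕ) (t : ℝ), |t| ≤ S.l₀ → ∀ τ ∈ S.T K, 0 ≤ S.A K t τ) ∧ (∀ (K : ℕ) (t : ℝ), |t| ≤ S.l₀ → ∀ τ ∈ S.T K, 0 ≤ S.B K t τ) ∧
        (∀ K, 1 - Real.exp (-SA K) ≤ S.W K) ∧ (∀ K, 1 - Real.exp (-SB K) ≤ S.W K) ∧
        (∀ K, 0 ≤ S.W K) ∧ (∀ K, S.W K < 1) ∧ Summable S.W) :
    S_N20 SRec := by
  intro F D g₀ os S hS
  obtain ⟨SA, SB, hDA, hDB, hA, hB, hWA, hWB, h0, h1, hs⟩ := hread F D g₀ os S hS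
  letI := S.dec
  exact relWeightBound_of_slotDom_slot hDA hDB hA hB hWA hWB h0 h1 hs

/-- **`S_N20` FOR EVERY PEIERLS READING** (two runs' `PeierlsDom` with their own budgets + the slot; §1 `relWeightBound_of_peierlsDom_slot`). [bookkeeping] -/
theorem s_N20_of_peierlsDomReading (SRec : SpineRecordPred N)
    (hread : ∀ (F : T4Family) (D : Datum F N) (g₀ : ℕ → ℝ) (os : List (ULoop F)) (S : SpineCarriers), SRec F D g₀ os S →
      ∃ SA SB : ℕ → ℝ, (letI := S.dec; PeierlsDom S.l₀ S.T S.A S.Bad SA) ∧ (letI := S.dec; PeierlsDom S.l₀ S.T S.B S.Bad SB) ∧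
        (∀ (K : ℕ) (t : ℝ), |t| ≤ S.l₀ → ∀ τ ∈ S.T K, 0 ≤ S.A K t τ) ∧ (∀ (K : ℕ) (t : ℝ), |t| ≤ S.l₀ → ∀ τ ∈ S.T K, 0 ≤ S.B K t τ) ∧
        (∀ K, 1 - Real.exp (-SA K) ≤ S.W K) ∧ (∀ K, 1 - Real.exp (-SB K) ≤ S.W K) ∧
        (∀ K, 0 ≤ S.W K) ∧ (∀ K, S.W K < 1) ∧ Summable S.W) :
    S_N20 SRec := by
  intro F D g₀ os S hS
  obtain ⟨SA, SB, hPA, hPB, hA, hB, hWA, hWB, h0, h1, hs⟩ := hread F D g₀ os S hS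
  letI := S.dec
  exact relWeightBound_of_peierlsDom_slot hPA hPB hA hB hWA hWB h0 h1 hs

/-- **`S_N20` FOR EVERY FIBRE-RATE READING** (two runs' `FibreRate` at their own constants and cuts + the slot dominating the two two-rate weights; §1
`relWeightBound_of_fibreRate_slot`). [bookkeeping] -/
theorem s_N20_of_fibreRateReading (SRec : SpineRecordPred N)
    (hread : ∀ (F : T4Family) (D : Datum F N) (g₀ : ℕ → ℝ) (os : List (ULoop F)) (S : SpineCarriers), SRec F D g₀ os S →
      ∃ (C V Λ σ C' V' Λ' σ' : ℝ) (jstar jstar' : ℕ → ℕ),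
        0 ≤ C ∧ 0 ≤ V ∧ 0 ≤ Λ ∧ 0 ≤ σ ∧ Λ * σ < 1 ∧ (∀ K, jstar K ≤ K) ∧
        0 ≤ C' ∧ 0 ≤ V' ∧ 0 ≤ Λ' ∧ 0 ≤ σ' ∧ Λ' * σ' < 1 ∧ (∀ K, jstar' K ≤ K) ∧
        (∀ (K : ℕ) (t : ℝ), |t| ≤ S.l₀ → ∀ τ ∈ S.T K, 0 ≤ S.A K t τ) ∧ (∀ (K : ℕ) (t : ℝ), |t| ≤ S.l₀ → ∀ τ ∈ S.T K, 0 ≤ S.B K t τ) ∧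
        (letI := S.dec; FibreRate S.l₀ S.T S.A S.Bad C V Λ σ jstar) ∧ (letI := S.dec; FibreRate S.l₀ S.T S.B S.Bad C' V' Λ' σ' jstar') ∧
        (∀ K, 1 - Real.exp (-(C * V * ((Λ * σ) ^ (K - jstar K + 1) / (1 - Λ * σ)))) ≤ S.W K) ∧
        (∀ K, 1 - Real.exp (-(C' * V' * ((Λ' * σ') ^ (K - jstar' K + 1) / (1 - Λ' * σ')))) ≤ S.W K) ∧
        (∀ K, 0 ≤ S.W K) ∧ (∀ K, S.W K < 1) ∧ Summable S.W) :
    S_N20 SRec := by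
  intro F D g₀ os S hS
  obtain ⟨C, V, Λ, σ, C', V', Λ', σ', jstar, jstar', hC, hV, hΛ, hσ, hr, hj, hC', hV', hΛ', hσ', hr', hj', hA, hB, hFA, hFB,
    hWA, hWB, h0, h1, hs⟩ := hread F D g₀ os S hS
  letI := S.dec
  exact relWeightBound_of_fibreRate_slot hC hV hΛ hσ hr hj hC' hV' hΛ' hσ' hr' hj' hA hB hFA hFB hWA hWB h0 h1 hs

/-- **`S_N20` FOR EVERY EVENT-DOMINATION READING** (renewal chains per fibre: two runs' `EventDom` at their own tilts, defects, budgets and cuts + the slot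
dominating the two resulting two-rate weights; §1 `relWeightBound_of_eventDom_slot`). [bookkeeping] -/
theorem s_N20_of_eventDomReading (SRec : SpineRecordPred N)
    (hread : ∀ (F : T4Family) (D : Datum F N) (g₀ : ℕ → ℝ) (os : List (ULoop F)) (S : SpineCarriers), SRec F D g₀ os S →
      ∃ (z η B₀ D₀ V Λ z' η' B₀' D₀' V' Λ' : ℝ) (jstar jstar' : ℕ → ℕ),
        0 < η ∧ 0 ≤ B₀ ∧ 0 ≤ D₀ ∧ 0 ≤ V ∧ 0 < Λ ∧ Λ < z ∧ (∀ K, jstar K ≤ K) ∧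
        0 < η' ∧ 0 ≤ B₀' ∧ 0 ≤ D₀' ∧ 0 ≤ V' ∧ 0 < Λ' ∧ Λ' < z' ∧ (∀ K, jstar' K ≤ K) ∧
        (∀ (K : ℕ) (t : ℝ), |t| ≤ S.l₀ → ∀ τ ∈ S.T K, 0 ≤ S.A K t τ) ∧ (∀ (K : ℕ) (t : ℝ), |t| ≤ S.l₀ → ∀ τ ∈ S.T K, 0 ≤ S.B K t τ) ∧
        (letI := S.dec; EventDom S.l₀ S.T S.A S.Bad z η B₀ D₀ V Λ jstar) ∧
        (letI := S.dec; EventDom S.l₀ S.T S.B S.Bad z' η' B₀' D₀' V' Λ' jstar') ∧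
        (∀ K, 1 - Real.exp (-(B₀ * D₀ / η * V * ((Λ * z⁻¹) ^ (K - jstar K + 1) / (1 - Λ * z⁻¹)))) ≤ S.W K) ∧
        (∀ K, 1 - Real.exp (-(B₀' * D₀' / η' * V' * ((Λ' * z'⁻¹) ^ (K - jstar' K + 1) / (1 - Λ' * z'⁻¹)))) ≤ S.W K) ∧
        (∀ K, 0 ≤ S.W K) ∧ (∀ K, S.W K < 1) ∧ Summable S.W) :
    S_N20 SRec := by
  intro F D g₀ os S hS
  obtain ⟨z, η, B₀, D₀, V, Λ, z', η', B₀', D₀', V', Λ', jstar, jstar', hη, hB₀, hD, hV, hΛ, hzΛ, hj, hη', hB₀', hD', hV', hΛ', hzΛ', hj',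
    hA, hB, hEA, hEB, hWA, hWB, h0, h1, hs⟩ := hread F D g₀ os S hS
  letI := S.dec
  exact relWeightBound_of_eventDom_slot hη hB₀ hD hV hΛ hzΛ hj hη' hB₀' hD' hV' hΛ' hzΛ' hj' hA hB hEA hEB hWA hWB h0 h1 hs

end Spine

/-! ## §4 Guards: the currency is INHABITED with non-empty bad classes, and `S_N20` fires on it -/

section Guards

variable {N : ℕ} [NeZero N]

/-- the product model's activities: `n+1` slots of activity `(1∕2)^{K+1}∕(n+1)` each at cutoff `K` sum to `(1∕2)^{K+1}` [bookkeeping] -/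
theorem productActivity_sum (n K : ℕ) :
    ∑ _i : Fin (n + 1), (1 / 2 : ℝ) ^ (K + 1) / ((n + 1 : ℕ) : ℝ) = (1 / 2 : ℝ) ^ (K + 1) := by
  rw [Finset.sum_const, Finset.card_univ, Fintype.card_fin, nsmul_eq_mul]
  have hn : ((n + 1 : ℕ) : ℝ) ≠ 0 := by positivity
  field_simp

/-- **THE CURRENCY IS INHABITED**: the independent-structure model of `T4HistoryPeeling` (§5 there) — terms = on∕off patterns of `n+1` slots, weights
`a₀·∏_{i on} u_K` with `u_K = (1∕2)^{K+1}∕(n+1)`, bad class = the patterns with a slot on, the same family at every source `t` — carries `SlotDom` at the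
budget `(1∕2)^{K+1}` (`slotDom_product`, the budget `Σ_i u_K` rewritten by `productActivity_sum` through `T4MatchingClosure.slotDom_mono`). [bookkeeping] -/
theorem slotDom_productModel (n : ℕ) (l₀ a₀ : ℝ) :
    SlotDom l₀ (fun _ => (Finset.univ : Finset (Fin (n + 1) → Bool)))
      (fun K _ τ => productWeight a₀ (fun _ : Fin (n + 1) => (1 / 2 : ℝ) ^ (K + 1) / ((n + 1 : ℕ) : ℝ)) τ)
      (fun _ _ => (productSwitchOff (n + 1)).bad) fun K => (1 / 2 : ℝ) ^ (K + 1) :=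
  slotDom_mono (slotDom_product (n := n + 1) l₀ a₀ (fun K _ => (1 / 2 : ℝ) ^ (K + 1) / ((n + 1 : ℕ) : ℝ))
    fun K _ => by positivity) fun K => (productActivity_sum n K).le

/-- **… WITH A NON-EMPTY BAD CLASS**: the all-on pattern has slot `0` pending. [bookkeeping] -/
theorem bad_productModel_nonempty (n : ℕ) : (productSwitchOff (n + 1)).bad.Nonempty := by
  refine ⟨fun _ => true, ?_⟩
  rw [SwitchOff.mem_bad]
  refine ⟨Finset.mem_univ _, ⟨0, Nat.succ_pos n⟩, ?_⟩
  simp [SwitchOff.charge, productSwitchOff]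

/-- **§1 FIRES ON THE PRODUCT MODEL**: both runs the product family (`a₀ ≥ 0`), the slot `W K = (1∕2)^{K+1}` (it dominates `1 − e^{−(1∕2)^{K+1}}` since
`1 − e^{−s} ≤ s`; `< 1`; summable) ⇒ `RelWeightBound` by `relWeightBound_of_slotDom_slot` — with the NON-EMPTY bad class of `bad_productModel_nonempty`, so
the §1∕§3 closers are not the empty implication. [bookkeeping] -/
theorem relWeightBound_productModel (n : ℕ) (l₀ a₀ : ℝ) (ha₀ : 0 ≤ a₀) :
    RelWeightBound l₀ (fun _ => (Finset.univ : Finset (Fin (n + 1) → Bool)))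
      (fun K _ τ => productWeight a₀ (fun _ : Fin (n + 1) => (1 / 2 : ℝ) ^ (K + 1) / ((n + 1 : ℕ) : ℝ)) τ)
      (fun K _ τ => productWeight a₀ (fun _ : Fin (n + 1) => (1 / 2 : ℝ) ^ (K + 1) / ((n + 1 : ℕ) : ℝ)) τ)
      (fun _ _ => (productSwitchOff (n + 1)).bad) fun K => (1 / 2 : ℝ) ^ (K + 1) := by
  have hA : ∀ (K : ℕ) (t : ℝ), |t| ≤ l₀ → ∀ τ ∈ (Finset.univ : Finset (Fin (n + 1) → Bool)),
      0 ≤ productWeight a₀ (fun _ : Fin (n + 1) => (1 / 2 : ℝ) ^ (K + 1) / ((n + 1 : ℕ) : ℝ)) τ :=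
    fun K _ _ τ _ => T4HistoryPeeling.productWeight_nonneg ha₀ (fun _ => by positivity) τ
  -- `1 − e^{−s} ≤ s` (from `1 + x ≤ e^x` at `x = −s`), at `s = (1∕2)^{K+1}`
  have hW : ∀ K, 1 - Real.exp (-(1 / 2 : ℝ) ^ (K + 1)) ≤ (1 / 2 : ℝ) ^ (K + 1) := fun K => by
    have := Real.add_one_le_exp (-(1 / 2 : ℝ) ^ (K + 1)); linarith
  exact relWeightBound_of_slotDom_slot (slotDom_productModel n l₀ a₀) (slotDom_productModel n l₀ a₀) hA hA hW hW
    (fun K => by positivity) (fun K => pow_lt_one₀ (by norm_num) (by norm_num) (Nat.succ_ne_zero K))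
    ((summable_geometric_two.mul_left (1 / 2 : ℝ)).congr fun K => by ring)

/-- **`S_N20` FIRES THROUGH THE SINGLE-SLOT READING.**  There are a carrier bundle `S₀` and a carrier predicate `SRec` over `SU(2)` data such that: `SRec`
pins exactly `S₀`; it is INHABITED (`T4FiniteEpsInhabited.nonempty_finiteEpsData_SU`); `S₀`'s bad class is NON-EMPTY at every cutoff and source, its
radius is `1`, its slot `(1∕2)^{K+1}` is positive; `S₀` CARRIES THIS CURRENCY — both runs' `SlotDom` over `S₀.T`, `S₀.Bad` at the budget `S₀.W` (the
product model with two slots, `a₀ = 1`, `slotDom_productModel`) —; and `S_N20 SRec` HOLDS by §3's `s_N20_of_slotDomReading` fed with exactly that reading.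
So the §3 closer's hypothesis is satisfiable with content, and it fires. [bookkeeping] -/
theorem s_N20_fires_on_slotDomReading :
    ∃ (S₀ : SpineCarriers) (SRec : SpineRecordPred 2),
      (∀ (F : T4Family) (D : Datum F 2) (g₀ : ℕ → ℝ) (os : List (ULoop F)) (S : SpineCarriers), SRec F D g₀ os S ↔ S = S₀) ∧
      (∃ (F : T4Family) (D : Datum F 2) (g₀ : ℕ → ℝ) (os : List (ULoop F)), SRec F D g₀ os S₀) ∧
      (∀ (K : ℕ) (t : ℝ), (S₀.Bad K t).Nonempty) ∧ 0 < S₀.l₀ ∧ (∀ K, 0 < S₀.W K) ∧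
      (letI := S₀.dec; SlotDom S₀.l₀ S₀.T S₀.A S₀.Bad S₀.W ∧ SlotDom S₀.l₀ S₀.T S₀.B S₀.Bad S₀.W) ∧
      S_N20 SRec := by
  let S₀ : SpineCarriers :=
    { ι := Fin (1 + 1) → Bool, l₀ := 1, vol := 1, K₀ := 0, T := fun _ => Finset.univ,
      A := fun K _ τ => productWeight 1 (fun _ : Fin (1 + 1) => (1 / 2 : ℝ) ^ (K + 1) / ((1 + 1 : ℕ) : ℝ)) τ,
      B := fun K _ τ => productWeight 1 (fun _ : Fin (1 + 1) => (1 / 2 : ℝ) ^ (K + 1) / ((1 + 1 : ℕ) : ℝ)) τ,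
      shA := fun _ _ _ => 0, shB := fun _ _ _ => 0, Bad := fun _ _ => (productSwitchOff (1 + 1)).bad,
      W := fun K => (1 / 2 : ℝ) ^ (K + 1), Wsh := fun _ => 0, δ := fun _ => 0 }
  obtain ⟨D⟩ := T4FiniteEpsInhabited.nonempty_finiteEpsData_SU (⟨13, ⟨⟨6, rfl⟩, by norm_num⟩, by norm_num, 1, le_rfl⟩ : T4Family) 2
  have hD : SlotDom S₀.l₀ S₀.T S₀.A S₀.Bad S₀.W := slotDom_productModel 1 1 1
  have hA : ∀ (K : ℕ) (t : ℝ), |t| ≤ S₀.l₀ → ∀ τ ∈ S₀.T K, 0 ≤ S₀.A K t τ :=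
    fun K _ _ τ _ => T4HistoryPeeling.productWeight_nonneg zero_le_one (fun _ => by positivity) τ
  have hW : ∀ K, 1 - Real.exp (-S₀.W K) ≤ S₀.W K := fun K => by
    have := Real.add_one_le_exp (-S₀.W K); linarith
  have h0 : ∀ K, 0 < S₀.W K := fun K => by positivity
  refine ⟨S₀, fun _ _ _ _ S => S = S₀, fun _ _ _ _ _ => Iff.rfl, ⟨_, D, fun _ => 1, [], rfl⟩, fun _ _ => bad_productModel_nonempty 1,
    one_pos, h0, ⟨hD, hD⟩, ?_⟩
  refine s_N20_of_slotDomReading _ fun F D' g₀ os S hS => ?_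
  subst hS
  exact ⟨S₀.W, S₀.W, hD, hD, hA, hA, hW, hW, fun K => (h0 K).le,
    fun K => pow_lt_one₀ (by norm_num) (by norm_num) (Nat.succ_ne_zero K),
    (summable_geometric_two.mul_left (1 / 2 : ℝ)).congr fun K => by ring⟩

end Guards

end

end Summit.QuantumFields.YangMills.BalabanUVNodes.N20RenewalCurrency
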